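import Mathlib

/-!
# EriceRemainderEnclosureHistoryAutonomyComparisonRenewalPositivity — (E70c) POSITIVITY OF DISCRETE RENEWAL SOLUTIONS WITH A NON-INCREASING KERNEL:
# if `ε_n = e_n − Σ_{j<K} W_j·ε_{n+1+j}` for every `n`, `ε_n ≥ 0` for `n ≥ N` (the base), `e` NON-INCREASING in the depth `n`, and the kernel is NON-NEGATIVE,
# NON-INCREASING with `W_0 ≤ 1` — then **`ε_n ≥ 0` for every `n`, WHATEVER THE MASS `Σ_j W_j`**; and the depth-dependent version: kernels `W^{(n)}` with the
# SHIFTED monotonicity `W^{(n)}_j ≤ ρ_n·W^{(n+1)}_{j−1}` (`j ≥ 1`) and `max(ρ_n, W^{(n)}_0)·e_{n+1} ≤ e_n`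

Cell `pub-balaban`, β-function sub-cell, BINDER row D4 «RemainderConst leaves for Bałaban's split» (`HOME/BINDER-OWNERS.md`; owner lineage `b2b-balaban-beta-an4`;
this file by co-owner #2 lineage `b2b-balaban-beta-d4-p2`, generation 60), β-FLOW TEAM duty (1), FREEZE (0) honoured (def-free; Mathlib only; nothing restated).

HONEST FRAMING (page 1, verbatim and binding).  *"Discharging BetaPertH makes Bałaban's UV stability UNCONDITIONAL — a real constructive-QFT result; it is
NOT the continuum limit and NOT the Clay problem."*  THIS FILE DISCHARGES NOTHING OF THE KIND.  Elementary real analysis about ABSTRACT real sequences —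
hypotheses of a census, not facts; the form, signs, ages and moments of Bałaban's (1.22) limit functional are NOT PRINTED ([I] p. 298; GAPS G-t4-U2-1∕-2)
and NOT asserted.  Row D4 class UNCHANGED (critical-path width 0; instance 0∕1; D4 DISCHARGE NO DATE).  HONEST DEPENDENCY: continuum YM on T⁴ ⇐ BetaPertH ∧
nine spine estimates (0/9 proved); BetaPertH ⇐ (D1) ∧ (D4) ∧ CAP+tail; G-an2-4 gates asym, D1 and NE2/3/4.

THE POINT (census sense (α); the COMPARISON column, conjecture (E58′); a mechanism TRANSVERSE to the budgeted certificates of (E65)–(E69)).  In (E58a)'s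
induction down the levels, write `ε_n = Φ′(z_n) − Φ(z_n)` for the excess of the effective β-functions at the `n`-th base orbit point below the pin and
`e_n = E(S′z_n)` for the excess functional there (`e ≥ 0`, NON-INCREASING in the depth `n` for an isotone `E`).  THE STEP says `ε_n = e_n − drop_n`, and to
first order `drop_n = Σ_j W^{(n)}_j·ε_{n+1+j}` with the TAIL-SUM kernel `W^{(n)}_j = Σ_{k>j} L_k·h_{n+k}³∕2` — NON-INCREASING IN THE LAG `j` FOR EVERY PROFILE
(tail sums of non-negative terms), with `W^{(n)}_0 = Σ_k x_k(z_n)∕k ≤ √2∕2` by (E65a)'s window budget at scale `1`.  §1: for a depth-INDEPENDENT kernel this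
structure ALONE forces `ε ≥ 0`, for every profile and every mass: with `Σ_n = Σ_j W_j ε_{n+1+j}`, monotonicity of `W` and `ε ≥ 0` deeper give
`Σ_n ≤ W_0·ε_{n+1} + Σ_{n+1} = e_{n+1} − (1 − W_0)·ε_{n+1} ≤ e_{n+1} ≤ e_n` (three lines; no certificate, no ratio hypothesis, no smallness beyond
`W_0 ≤ 1`; the base «`ε ≥ 0` below depth `N` WITH the equation» matters — with a hard floor `ε = e` below `N` a kernel of mass `> 1` overshoots).  §2: along a real trajectory the kernel GROWS towards the pin, `W^{(n)}_j ≤ ρ_n·W^{(n+1)}_{j−1}` with `ρ_n = max_k (h_{n+k}∕h_{n+k+1})³`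
(`≤ ((n+2)∕(n+1))^{3∕2}` by the level concavity; the shift `j ↦ j−1` absorbs the rest and the term `k = j` of `W^{(n+1)}_{j−1}` is pure outflow), and the same
three lines give `ε_n ≥ 0` whenever `max(ρ_n, W^{(n)}_0)·e_{n+1} ≤ e_n` — i.e. when the excess functional `E` lives on ages young enough that `e` grows
towards the pin at least as fast as the kernel (numerics `HOME/b2b-balaban-beta-d4-p2/g60/e70/README.md`: kernel rate `≈ 3θ∕(2(n+k))` against excess rate
`≈ θ′∕(2(n+k_E))` — the generic shortfall is a factor `3` in RATES at depth, to be recovered from the outflow `Σ_k L_k h_{n+k}³ε_{n+1+k}∕2` and the negative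
level feedback that §1–§2 discard).  NOT CLAIMED: any comparison theorem for the flow (the identification `drop_n ≤ Σ_j W^{(n)}_j ε_{n+1+j}` along the
comparison configuration is (E64e)'s slack bookkeeping and is not re-derived here); anything printed.

WHAT IS PROVED ([folklore]; 0 `def`, 0 sorry).  §1 `shift_sum_le`, `sum_split_first`, **`renewal_nonneg`** (constant kernel, any mass).  §2
**`renewal_nonneg_of_growth`** (depth-dependent kernel `W^{(n)}` under the shifted monotonicity `W^{(n)}_{j+1} ≤ ρ_n·W^{(n+1)}_j` and the growth conditions
`ρ_n·e_{n+1} ≤ e_n`, `W^{(n)}_0·e_{n+1} ≤ e_n`).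
-/
noncomputable section
open Finset

namespace Summit.QuantumFields.BalabanUV.Beta.EriceRemainderEnclosureHistoryAutonomyComparisonRenewalPositivity

variable {W e ε ρ : ℕ → ℝ} {V : ℕ → ℕ → ℝ} {K N : ℕ}

/-! ## §1 Constant non-increasing kernel: positivity at any mass -/

/-- The monotone shift: `Σ_{j<K} W_{j+1}·v_j ≤ Σ_{j<K} W_j·v_j` for `v ≥ 0` on the window and `W` non-increasing. [folklore] -/
theorem shift_sum_le (hW : ∀ j, W (j + 1) ≤ W j) {v : ℕ → ℝ} (hv : ∀ j < K, 0 ≤ v j) :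
    ∑ j ∈ range K, W (j + 1) * v j ≤ ∑ j ∈ range K, W j * v j :=
  sum_le_sum fun j hj => mul_le_mul_of_nonneg_right (hW j) (hv j (mem_range.mp hj))

/-- Splitting off the first lag and re-indexing the rest: `Σ_{j<K+1} U_j·ε_{n+1+j} = U_0·ε_{n+1} + Σ_{j<K} U_{j+1}·ε_{n+2+j}`. [folklore] -/
theorem sum_split_first (U ε : ℕ → ℝ) (n K : ℕ) :
    ∑ j ∈ range (K + 1), U j * ε (n + 1 + j) = U 0 * ε (n + 1) + ∑ j ∈ range K, U (j + 1) * ε (n + 2 + j) := by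
  rw [sum_range_succ']
  have : ∀ j ∈ range K, U (j + 1) * ε (n + 1 + (j + 1)) = U (j + 1) * ε (n + 2 + j) := fun j _ => by ring_nf
  rw [sum_congr rfl this]
  ring

/-- **POSITIVITY OF RENEWAL SOLUTIONS WITH A NON-INCREASING KERNEL, AT ANY MASS.**  `W` non-increasing with `W_0 ≤ 1` and `W_j = 0` for `j ≥ K` (so `W ≥ 0`);
`e` non-increasing in the depth; `ε_n = e_n − Σ_{j<K} W_j·ε_{n+1+j}` for EVERY `n`, and `ε_n ≥ 0` for `n ≥ N`.  Then `ε_n ≥ 0` for every `n`.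
Downward induction: with `Σ_n = Σ_{j<K} W_jε_{n+1+j}` and all deeper `ε ≥ 0`, `Σ_n ≤ W_0ε_{n+1} + Σ_{n+1} = e_{n+1} − (1−W_0)ε_{n+1} ≤ e_{n+1} ≤ e_n`.
[folklore] -/
theorem renewal_nonneg (hW : ∀ j, W (j + 1) ≤ W j) (hW1 : W 0 ≤ 1) (hWK : ∀ j, K ≤ j → W j = 0)
    (he : ∀ n, e (n + 1) ≤ e n) (heq : ∀ n, ε n = e n - ∑ j ∈ range K, W j * ε (n + 1 + j)) (hbase : ∀ n, N ≤ n → 0 ≤ ε n) :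
    ∀ n, 0 ≤ ε n := by
  suffices h : ∀ d n, N ≤ n + d → 0 ≤ ε n from fun n => h N n (Nat.le_add_left N n)
  intro d
  induction d with
  | zero => intro n hn; exact hbase n (by simpa using hn)
  | succ d ih =>
    intro n hn
    by_cases hnN : N ≤ n
    · exact hbase n hnN
    have hdeep : ∀ m, n < m → 0 ≤ ε m := fun m hm => ih m (by omega)
    -- Σ_n = W_0 ε_{n+1} + Σ_j W_{j+1} ε_{n+2+j} ≤ W_0 ε_{n+1} + Σ_{n+1}
    have hK1 : ∑ j ∈ range K, W j * ε (n + 1 + j) = ∑ j ∈ range (K + 1), W j * ε (n + 1 + j) := by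
      rw [sum_range_succ, hWK K le_rfl, zero_mul, add_zero]
    have hshift : ∑ j ∈ range K, W (j + 1) * ε (n + 2 + j) ≤ ∑ j ∈ range K, W j * ε (n + 2 + j) :=
      shift_sum_le hW fun j _ => hdeep _ (by omega)
    have e2 : ∑ j ∈ range K, W j * ε (n + 1 + 1 + j) = ∑ j ∈ range K, W j * ε (n + 2 + j) :=
      sum_congr rfl fun j _ => by ring_nf
    have heq1 := heq (n + 1)
    rw [e2] at heq1
    have hε1 : 0 ≤ ε (n + 1) := hdeep _ (Nat.lt_succ_self n)
    have hSn : ∑ j ∈ range K, W j * ε (n + 1 + j) ≤ e (n + 1) - (1 - W 0) * ε (n + 1) := by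
      rw [hK1, sum_split_first]; linarith
    have : ∑ j ∈ range K, W j * ε (n + 1 + j) ≤ e n := by
      have : 0 ≤ (1 - W 0) * ε (n + 1) := mul_nonneg (by linarith) hε1
      linarith [he n]
    rw [heq n]; linarith

/-! ## §2 Depth-dependent kernel: shifted monotonicity and the growth condition -/

/-- **POSITIVITY UNDER KERNEL GROWTH.**  Kernels `V n ≥ 0` (depth `n`, lag index `j`) with `V n j = 0` for `j ≥ K`, the SHIFTED monotonicity
`V n (j+1) ≤ ρ_n·V (n+1) j` (the lag-`(j+1)` weight at depth `n` against the lag-`j` weight one level deeper), and `ε_n = e_n − Σ_{j<K} V n j·ε_{n+1+j}`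
for every `n`, `ε_n ≥ 0` for `n ≥ N`.  If the excess grows towards the pin at least as fast as the kernel — `ρ_n·e_{n+1} ≤ e_n` and `V n 0·e_{n+1} ≤ e_n` —
then `ε_n ≥ 0` for every `n`: `Σ_n ≤ V n 0·ε_{n+1} + ρ_nΣ_{n+1} = ρ_n e_{n+1} + (V n 0 − ρ_n)ε_{n+1} ≤ max(ρ_n, V n 0)·e_{n+1} ≤ e_n` (using `0 ≤ ε_{n+1} ≤ e_{n+1}`).
Along a box solution of the affine-memory flow the first-order kernel is `V n j = Σ_{k>j} L_k h_{n+k}³∕2` and `ρ_n = max_k (h_{n+k}∕h_{n+k+1})³`. [folklore] -/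
theorem renewal_nonneg_of_growth (hV0 : ∀ n j, 0 ≤ V n j) (hVK : ∀ n j, K ≤ j → V n j = 0)
    (hshift : ∀ n j, V n (j + 1) ≤ ρ n * V (n + 1) j)
    (hgρ : ∀ n, ρ n * e (n + 1) ≤ e n) (hgV : ∀ n, V n 0 * e (n + 1) ≤ e n)
    (heq : ∀ n, ε n = e n - ∑ j ∈ range K, V n j * ε (n + 1 + j)) (hbase : ∀ n, N ≤ n → 0 ≤ ε n) :
    ∀ n, 0 ≤ ε n := by
  suffices h : ∀ d n, N ≤ n + d → 0 ≤ ε n from fun n => h N n (Nat.le_add_left N n)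
  intro d
  induction d with
  | zero => intro n hn; exact hbase n (by simpa using hn)
  | succ d ih =>
    intro n hn
    by_cases hnN : N ≤ n
    · exact hbase n hnN
    have hdeep : ∀ m, n < m → 0 ≤ ε m := fun m hm => ih m (by omega)
    have hK1 : ∑ j ∈ range K, V n j * ε (n + 1 + j) = ∑ j ∈ range (K + 1), V n j * ε (n + 1 + j) := by
      rw [sum_range_succ, hVK n K le_rfl, zero_mul, add_zero]
    -- shifted monotonicity with growth: Σ_j V n (j+1) ε_{n+2+j} ≤ ρ_n Σ_j V (n+1) j ε_{n+2+j}
    have hshift' : ∑ j ∈ range K, V n (j + 1) * ε (n + 2 + j) ≤ ρ n * ∑ j ∈ range K, V (n + 1) j * ε (n + 2 + j) := by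
      rw [mul_sum]
      exact sum_le_sum fun j _ => by
        have := mul_le_mul_of_nonneg_right (hshift n j) (hdeep (n + 2 + j) (by omega))
        linarith [mul_assoc (ρ n) (V (n + 1) j) (ε (n + 2 + j))]
    have e2 : ∑ j ∈ range K, V (n + 1) j * ε (n + 1 + 1 + j) = ∑ j ∈ range K, V (n + 1) j * ε (n + 2 + j) :=
      sum_congr rfl fun j _ => by ring_nf
    have heq1 := heq (n + 1)
    rw [e2] at heq1
    have hε1 : 0 ≤ ε (n + 1) := hdeep _ (Nat.lt_succ_self n)
    have hS1 : 0 ≤ ∑ j ∈ range K, V (n + 1) j * ε (n + 2 + j) :=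
      sum_nonneg fun j _ => mul_nonneg (hV0 _ _) (hdeep _ (by omega))
    have hε1e : ε (n + 1) ≤ e (n + 1) := by linarith
    -- Σ_n ≤ V n 0 ε_{n+1} + ρ_n (e_{n+1} − ε_{n+1})
    have hSn : ∑ j ∈ range K, V n j * ε (n + 1 + j) ≤ V n 0 * ε (n + 1) + ρ n * (e (n + 1) - ε (n + 1)) := by
      rw [hK1, sum_split_first]
      have : ∑ j ∈ range K, V (n + 1) j * ε (n + 2 + j) = e (n + 1) - ε (n + 1) := by linarith
      rw [← this]; linarith
    -- two cases on which of ρ_n, V n 0 is larger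
    have hbound : ∑ j ∈ range K, V n j * ε (n + 1 + j) ≤ e n := by
      by_cases hc : V n 0 ≤ ρ n
      · have : (V n 0 - ρ n) * ε (n + 1) ≤ 0 := mul_nonpos_of_nonpos_of_nonneg (by linarith) hε1
        nlinarith [hgρ n]
      · have hc' : ρ n ≤ V n 0 := (not_le.mp hc).le
        have : (V n 0 - ρ n) * ε (n + 1) ≤ (V n 0 - ρ n) * e (n + 1) := mul_le_mul_of_nonneg_left hε1e (by linarith)
        nlinarith [hgV n]
    rw [heq n]; linarith

end Summit.QuantumFields.BalabanUV.Beta.EriceRemainderEnclosureHistoryAutonomyComparisonRenewalPositivity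

end
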